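import Summits.ABC.IUTFork.Cor312ThetaFiniteDHVol
import HarnessLib

/-!
# [IUTchIII] Corollary 3.12, statement — c312-6's `BridgeHyps` for the real setting with the verbatim volumes,
# EVERY field discharged, from FIVE transparent conditions on the Θ-boxes

Record-only file (D-0012) of the abc-iut cell (Cor. 3.12 sub-crew, seat abc-iut-c312-5, gen 3; D-0067 TEAM A row
A-0 «finiteness + BridgeHyps at the real setting» — closes the three named leftovers `hθ`, `hfinθ`, `ThetaFinite`
of gen 2's `Real.bridgeHyps_settingDHVol` modulo conditions on the Θ-box binder only); TAKES NO SIDE. [IUTchIII]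
Cor. 3.12 (kurims `paper:url-4b091feeb646` p. 173 l. 41 – p. 174 l. 19) reads "the holomorphic hull … of the union
of the possible images of a Θ-pilot object … which we regard as subject to the indeterminacies (Ind1), (Ind2),
(Ind3)"; its proof (p. 175 l. 2–4) asserts "that the quantity `−|log(Θ)|` is finite". For c312-5's
`Real.settingDHVol` (the setting of Cor. 3.12 over the real Dupuy–Hilado-level log-shells of `F` WITH THE VERBATIM
container of [IUTchIII] Rmk. 3.1.1 (ii)(iii); the Θ-boxes a BINDER `thetaBox`) this file PROVES:

* `adm_thetaRegion3_settingDHVol_inl/_inr`: the (Ind3)-enlarged Θ-region `e⁻¹(⋃ₘ boxes)` is ADMISSIBLE — at `∞` as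
  soon as some box is nonempty (trivial archimedean container of `Cor312VolumesRealAssembly`), at `p` as soon as
  the union of the boxes is a DIRECT PRODUCT over the summands `v⃗` of sets of positive finite Haar measure
  ([IUTchIII] Rmk. 3.1.1 (iii) "direct product regions");
* `hfinθ_settingDHVol`: its log-volume is FINITELY SUPPORTED over `v_ℚ` as soon as the boxes are the unit polydisc
  `𝒪_L` off a finite prime set (there the region is `e⁻¹(Π_{v⃗} (R_{v⃗})^∼)`, of log-volume `0` at EVERY prime —
  Dupuy–Hilado normalisation (3.6));
* **`bridgeHyps_settingDHVol_of_boxes`**: c312-6's `BridgeHyps` for `Real.settingDHVol` — `mono`, `image_adm`,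
  `image_fin`, `hul_nonempty`, `theta_nonempty` (gen 2), `hθ`, `hfinθ` (here), `ThetaFinite`
  (`Cor312ThetaFiniteDHVol`) — from the five Θ-box conditions ONLY: (1) some box at `∞` nonempty; (2) product-shaped
  admissible at every prime; (3) bounded (Dupuy–Hilado (4.10)); (4) nondegenerate; (5) `= 𝒪_L` off a finite prime
  set. What these mean for the Θ-pilot object of [IUTchIII] Def. 3.8 (i) is the box provider's statement
  (abc-iut-c312-3 `Ind3Datum`); nothing here asserts them.
[claim: Mochizuki2012, status: disputed] for the quoted sentences; [cite: DupuyHilado2025, Def. 3.6.1, §4.10].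
Deliberately NOT here: the Statement of Cor. 3.12, any reading of Step (xi), any judgement.
-/

noncomputable section

open Set Function NumberField IsDedekindDomain Bornology
open scoped Pointwise

namespace Summit.ABC

namespace IUTFork

namespace Thm311

namespace Real

open Cor312 Cor312Vol Literature.IUT.LogThetaLattice Literature.IUT.LogVolume

variable {F : Type} [Field F] [NumberField F] (X : PilotData F) {logv : PadicLogs F} (hlog : LogvAnalytic logv)

section Setting

variable (M : Type) [Field M] [NumberField M]
  (archPk : ∀ (j : (thetaIndex X).Label) (vQ : (thetaIndex X).VQ), Set ((logShellsDH X logv).Packet j vQ))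
  (archSub : ∀ (j : (thetaIndex X).Label) (v : (thetaIndex X).V),
    Set ((logShellsDH X logv).Packet j ((thetaIndex X).over v)))
  (Ψ : ℤ → ∀ v : (thetaIndex X).V, v ∈ (thetaIndex X).Vbad → Set ((logShellsDH X logv).StarPacket v))
  (act : ℤ → ∀ v : (thetaIndex X).V, v ∈ (thetaIndex X).Vbad →
    (logShellsDH X logv).StarPacket v → Module.End ℚ ((logShellsDH X logv).StarPacket v))
  (Mmod : ℤ → ∀ j : (thetaIndex X).LabelStar, Set ((logShellsDH X logv).GlobalPacket j.1))
  (region : ℤ → ∀ j : (thetaIndex X).LabelStar, FinDivisor M → ∀ vQ : (thetaIndex X).VQ,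
    Set ((logShellsDH X logv).Packet j.1 vQ))
  (n : ℤ) {HT : Type} {LogLink : HT → HT → Type} {IsFull : ∀ {s t : HT}, LogLink s t → Prop}
  (lat : LGPGaussianLogThetaLattice LogLink IsFull)
  {Frd : Type} {IsoF : Frd → Frd → Type} {Ob : Frd → Type} {realify : Frd → Frd} {Strip : Type}
  {IsoS : Strip → Strip → Type} {Mv : ∀ v : (thetaIndex X).V, v ∈ (thetaIndex X).Vbad → Type}
  [∀ v h, Monoid (Mv v h)]
  (sig : GlobalLGPFrobenioidSignature (thetaIndex X).lstar (thetaIndex X).V (· ∈ (thetaIndex X).Vbad)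
    Frd IsoF Ob realify Strip IsoS Mv)
  (split : SplittingMonoids Mv) {ObΔ : Type} {N : ∀ v : (thetaIndex X).V, v ∈ (thetaIndex X).Vbad → Type}
  [∀ v h, Monoid (N v h)] (qData : QPilotData ObΔ N)
  (thetaBox : ℤ → Ob sig.Clgp → ∀ (j : (thetaIndex X).Label) (vQ : (thetaIndex X).VQ),
    Set (∀ s : factorIdxDH X hlog j vQ, factorFieldDH X hlog j vQ s))
  (qCentre : ObΔ → ∀ (j : (thetaIndex X).Label) (vQ : (thetaIndex X).VQ),
    ∀ s : factorIdxDH X hlog j vQ, factorFieldDH X hlog j vQ s)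
  (hq : ∀ j vQ s, qCentre (qPilotObject qData) j vQ s ≠ 0)
  (hfin : ∀ j : (thetaIndex X).Label, (Function.support fun vQ =>
    ((situationDHVol X hlog M archPk archSub Ψ act Mmod region).D n).logvol j vQ
      (factorMapDH X hlog j vQ ⁻¹' hullSet (factorFieldDH X hlog j vQ) (qCentre (qPilotObject qData) j vQ))).Finite)

/-! ## 1. The (Ind3)-region: admissible, with finitely supported log-volume -/

/-- At `∞` the (Ind3)-region is admissible in the (trivial) archimedean container as soon as SOME Θ-box there is
nonempty. [claim: Mochizuki2012, status: disputed] -/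
theorem adm_thetaRegion3_settingDHVol_inl (j : (thetaIndex X).Label) (u : Unit)
    (hne : (⋃ m : ℤ, thetaBox m (thetaPilotObject sig split) j (.inl u)).Nonempty) :
    ((situationDHVol X hlog M archPk archSub Ψ act Mmod region).D n).Adm j (.inl u) (
        (settingDHVol X hlog M archPk archSub Ψ act Mmod region n lat sig split qData thetaBox qCentre
          hq hfin).thetaRegion3 j (.inl u)) := by
  refine (LocalPieces.adm_trivial_iff (logShellsDH X logv) (.inl u) j _).2 ⟨0, ?_⟩
  obtain ⟨z, hz⟩ := hne
  rw [thetaRegion3_settingDHVol, Set.mem_preimage]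
  have h0 : factorMapDH X hlog j (.inl u) 0 = z := funext fun s => s.elim
  rw [h0]
  exact hz

/-- At a prime the (Ind3)-region is admissible in the verbatim container as soon as the union of the Θ-boxes is
(the image of) a DIRECT PRODUCT over the summands `v⃗` of sets of positive finite Haar measure ([IUTchIII] Rmk.
3.1.1 (iii) "direct product regions"). [claim: Mochizuki2012, status: disputed] -/
theorem adm_thetaRegion3_settingDHVol_inr (j : (thetaIndex X).Label) (pp : Nat.Primes)
    (hprod : haveI : Fact (pp : ℕ).Prime := ⟨pp.2⟩
      ∃ R : ∀ e : (thetaIndex X).Caps j → (thetaIndex X).Fibre (.inr pp), Set ((presAt X hlog pp).X e),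
        (∀ e, PacketAdm (pp : ℕ) ((presAt X hlog pp).kk e) (R e)) ∧
        (⋃ m : ℤ, thetaBox m (thetaPilotObject sig split) j (.inr pp)) =
          (presAt X hlog pp).factorCoords j '' Set.pi univ R) :
    ((situationDHVol X hlog M archPk archSub Ψ act Mmod region).D n).Adm j (.inr pp) (
        (settingDHVol X hlog M archPk archSub Ψ act Mmod region n lat sig split qData thetaBox qCentre
          hq hfin).thetaRegion3 j (.inr pp)) := by
  haveI : Fact (pp : ℕ).Prime := ⟨pp.2⟩
  obtain ⟨R, hR, hU⟩ := hprod
  have hset :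
      (settingDHVol X hlog M archPk archSub Ψ act Mmod region n lat sig split qData thetaBox qCentre
        hq hfin).thetaRegion3 j (.inr pp) = (presAt X hlog pp).comparison j ⁻¹' Set.pi univ R := by
    rw [thetaRegion3_settingDHVol]
    ext x
    have hx : factorMapDH X hlog j (.inr pp) x =
        (presAt X hlog pp).factorCoords j ((presAt X hlog pp).comparison j x) :=
      congrFun (factorMapDH_inr X hlog j pp) x
    constructor
    · intro h
      have h' : factorMapDH X hlog j (.inr pp) x ∈ (presAt X hlog pp).factorCoords j '' Set.pi univ R := hU ▸ h
      obtain ⟨y, hy, hyx⟩ := h'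
      have hy' : y = (presAt X hlog pp).comparison j x :=
        (presAt X hlog pp).factorCoords_injective j (hyx.trans hx)
      show (presAt X hlog pp).comparison j x ∈ Set.pi univ R
      rw [← hy']
      exact hy
    · intro h
      have h' : factorMapDH X hlog j (.inr pp) x ∈ (presAt X hlog pp).factorCoords j '' Set.pi univ R :=
        ⟨_, h, hx.symm⟩
      show factorMapDH X hlog j (.inr pp) x ∈ ⋃ m : ℤ, thetaBox m (thetaPilotObject sig split) j (.inr pp)
      rw [hU]
      exact h'
  rw [hset]
  exact ⟨R, Set.image_preimage_eq _ ((presAt X hlog pp).comparison_surjective j), hR⟩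

/-- At `∞` every region has log-volume `0` in the (trivial) archimedean container. [folklore] -/
theorem logvol_settingDHVol_inl (j : (thetaIndex X).Label) (u : Unit)
    (A : Set ((logShellsDH X logv).Packet j (.inl u))) :
    ((situationDHVol X hlog M archPk archSub Ψ act Mmod region).D n).logvol j (.inl u) A = 0 := by
  refine ((realizes_situationDHVol X hlog M archPk archSub Ψ act Mmod region n).logvol_eq j (.inl u) A).trans ?_
  exact Finset.sum_eq_zero fun e _ => by
    rw [show (summandPiecesDH X hlog).w j (.inl u) e = 0 from rfl, zero_mul]

/-- Where the union of the Θ-boxes is the unit polydisc, the (Ind3)-region is `e⁻¹(Π_{v⃗} (R_{v⃗})^∼)` — admissible of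
log-volume `0` (at EVERY such prime, ramified or not). [claim: Mochizuki2012, status: disputed] -/
theorem thetaRegion3_settingDHVol_eq_of_box (j : (thetaIndex X).Label) (pp : Nat.Primes)
    (hbox : (⋃ m : ℤ, thetaBox m (thetaPilotObject sig split) j (.inr pp)) =
      hullSet (factorFieldDH X hlog j (.inr pp)) (fun _ => 1)) :
    haveI : Fact (pp : ℕ).Prime := ⟨pp.2⟩
    (settingDHVol X hlog M archPk archSub Ψ act Mmod region n lat sig split qData thetaBox qCentre
          hq hfin).thetaRegion3 j (.inr pp) = (presAt X hlog pp).comparison j ⁻¹' Set.pi univ fun e =>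
      (normalizedPacket (pp : ℕ) ((presAt X hlog pp).kk e) : Set ((presAt X hlog pp).X e)) := by
  rw [thetaRegion3_settingDHVol, hbox]
  exact preimage_factorMapDH_hullSet_one X hlog j pp

/-- **Finite support of the (Ind3)-region's log-volume** (`hfinθ` of gen 2's `bridgeHyps_settingDHVol`) from
"boxes = unit polydisc off a finite prime set". [claim: Mochizuki2012, status: disputed] -/
theorem hfinθ_settingDHVol (i : Fin (thetaIndex X).lstar)
    (hcof : {pp : Nat.Primes |
      (⋃ m : ℤ, thetaBox m (thetaPilotObject sig split) (Setting.labelSucc i) (.inr pp)) ≠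
        hullSet (factorFieldDH X hlog (Setting.labelSucc i) (.inr pp)) (fun _ => 1)}.Finite) :
    (Function.support fun vQ : (thetaIndex X).VQ => ((situationDHVol X hlog M archPk archSub Ψ act Mmod region).D n).logvol _ vQ
      (
          (settingDHVol X hlog M archPk archSub Ψ act Mmod region n lat sig split qData thetaBox qCentre
            hq hfin).thetaRegion3 (Setting.labelSucc i) vQ)).Finite := by
  refine ((Set.finite_range Sum.inl).union ((hcof).image Sum.inr)).subset ?_
  intro vQ hvQ
  rcases vQ with u | pp
  · exact Or.inl ⟨u, rfl⟩
  · refine Or.inr ⟨pp, ?_, rfl⟩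
    by_contra hpp
    simp only [Set.mem_setOf_eq, ne_eq, not_not] at hpp
    have h0 : ((situationDHVol X hlog M archPk archSub Ψ act Mmod region).D n).logvol _ (.inr pp)
        (
            (settingDHVol X hlog M archPk archSub Ψ act Mmod region n lat sig split qData thetaBox qCentre
              hq hfin).thetaRegion3 (Setting.labelSucc i) (.inr pp)) = 0 := by
      rw [thetaRegion3_settingDHVol_eq_of_box
          X hlog M archPk archSub Ψ act Mmod region n lat sig split qData thetaBox qCentre hq hfin _ pp hpp]
      exact logvol_preimage_normalizedPacket_settingDHVol X hlog M archPk archSub Ψ act Mmod region n _ pp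
    exact absurd h0 hvQ

/-! ## 2. `BridgeHyps` from the five Θ-box conditions -/

/-- **c312-6's `BridgeHyps` for the real setting with the verbatim volumes — EVERY field discharged — from five
transparent conditions on the Θ-boxes of the Θ-pilot object**: (1) some box at `∞` is nonempty; (2) at every prime
the union over `m` of the boxes is a direct product over the summands of positive-finite-measure sets; (3) it is
bounded (Dupuy–Hilado (4.10)) and (4) nondegenerate; (5) at all but finitely many primes it is the unit polydisc
`𝒪_L`. Composes gen 2's `bridgeHyps_settingDHVol` (mono/image_adm/image_fin/hul_nonempty/theta_nonempty) with
this file's `hθ`/`hfinθ`/`ThetaFinite`. [claim: Mochizuki2012, status: disputed] -/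
theorem bridgeHyps_settingDHVol_of_boxes
    (hne : ∀ (i : Fin (thetaIndex X).lstar) (u : Unit),
      (⋃ m : ℤ, thetaBox m (thetaPilotObject sig split) (Setting.labelSucc i) (.inl u)).Nonempty)
    (hprod : ∀ (i : Fin (thetaIndex X).lstar) (pp : Nat.Primes), haveI : Fact (pp : ℕ).Prime := ⟨pp.2⟩
      ∃ R : ∀ e : (thetaIndex X).Caps (Setting.labelSucc i) → (thetaIndex X).Fibre (.inr pp),
          Set ((presAt X hlog pp).X e),
        (∀ e, PacketAdm (pp : ℕ) ((presAt X hlog pp).kk e) (R e)) ∧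
        (⋃ m : ℤ, thetaBox m (thetaPilotObject sig split) (Setting.labelSucc i) (.inr pp)) =
          (presAt X hlog pp).factorCoords (Setting.labelSucc i) '' Set.pi univ R)
    (hbdd : ∀ (i : Fin (thetaIndex X).lstar) (pp : Nat.Primes),
      Bornology.IsBounded (⋃ m : ℤ, thetaBox m (thetaPilotObject sig split) (Setting.labelSucc i) (.inr pp)))
    (hnd : ∀ (i : Fin (thetaIndex X).lstar) (pp : Nat.Primes),
      IsNondegenerate (factorFieldDH X hlog (Setting.labelSucc i) (.inr pp))
        (⋃ m : ℤ, thetaBox m (thetaPilotObject sig split) (Setting.labelSucc i) (.inr pp)))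
    (hcof : ∀ i : Fin (thetaIndex X).lstar, {pp : Nat.Primes |
      (⋃ m : ℤ, thetaBox m (thetaPilotObject sig split) (Setting.labelSucc i) (.inr pp)) ≠
        hullSet (factorFieldDH X hlog (Setting.labelSucc i) (.inr pp)) (fun _ => 1)}.Finite) :
    BridgeHyps
        (settingDHVol X hlog M archPk archSub Ψ act Mmod region n lat sig split qData thetaBox qCentre
          hq hfin) :=
  bridgeHyps_settingDHVol X hlog M archPk archSub Ψ act Mmod region n lat sig split qData thetaBox qCentre hq hfin
    (fun i vQ => match vQ with
      | .inl u => adm_thetaRegion3_settingDHVol_inl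
          X hlog M archPk archSub Ψ act Mmod region n lat sig split qData thetaBox qCentre hq hfin _ u (hne i u)
      | .inr pp => adm_thetaRegion3_settingDHVol_inr
          X hlog M archPk archSub Ψ act Mmod region n lat sig split qData thetaBox qCentre hq hfin _ pp (hprod i pp))
    (fun i => hfinθ_settingDHVol
        X hlog M archPk archSub Ψ act Mmod region n lat sig split qData thetaBox qCentre hq hfin i (hcof i))
    (thetaFinite_settingDHVol
        X hlog M archPk archSub Ψ act Mmod region n lat sig split qData thetaBox qCentre hq hfin hbdd hnd hcof)

end Setting

end Real

end Thm311

end IUTFork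

end Summit.ABC

end
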